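import Literature.NumberTheory.LFunctions.Zhang2022.RepairFormulaIGram

/-!
# Zhang (2022), programme F-S3 (cell landau-siegel, family B-det): the zero DETECTOR as data —
# the discrete form `Ξ_w`, its exact Cauchy–Schwarz, and formula I for a three-channel detector recipe

Y. Zhang, *Discrete mean estimates and the Landau–Siegel zero*, arXiv:2211.02515v1 [Zhang2022LandauSiegel] —
an unrefereed manuscript under adjudication. **WHAT THIS IS NOT: not a claim about Theorems 1–2 of
arXiv:2211.02515, about Landau–Siegel zeros, or about Parity; nothing here asserts any claim of the manuscript.**
«The programme SEARCHES and TYPES; no claim about Landau–Siegel zeros, Theorems 1–2 of arXiv:2211.02515 or a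
repaired Margin232 until a kernel theorem says so.» This file is definition request **D-det-1** of the cell's
`OBJECTIVE.md` §3.4 (`FormDet` / `FormS`): the vocabulary in which an ALTERNATIVE ZERO-DETECTOR for the §2
endgame is a design parameter, typed over the F-S1R kit (`Repair.Mform`, `Repair.dipoleIntegrand`,
`Repair.KinkedProfile`, `mainTermFormPolar`, `mainTermForm`).

**Part 1 — the discrete form of a detector (exact).** The §2 endgame runs on the discrete pairing
`Ξ_w(u,v) = Σ_{ρ ∈ Z} w(ρ)·u(ρ)·conj v(ρ)` over a finite set `Z` of sampled zeros (the manuscript: `Z` = the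
pairs `(ψ, ρ)`, `ψ ∈ Ψ₁`, `ρ ∈ 𝔷(ψ)`; `w = 𝔠*(ρ,ψ)ω(ρ)`, (2.16)–(2.17); the tree's `Zhang2022.idx`, `cstar`,
`omegaW`). `discreteForm Z w u v` is that pairing with the WEIGHT `w` as data. PROVED here (elementary, the
content of the repair cell's LEVERS §0.6 (B1)–(B2)): for `w ≥ 0` on `Z` the form is Hermitian with real
non-negative diagonal and satisfies Cauchy–Schwarz EXACTLY, `‖Ξ_w(u,v)‖² ≤ Ξ_w(u,u)·Ξ_w(v,v)`
(`norm_sq_discreteForm_le`); and main-order constants inherit it: if along any filter of designs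
`Ξ(u,u)/X → A`, `Ξ(v,v)/X → C`, `Ξ(u,v)/X → B` with `X > 0` and CS at each stage, then `‖B‖² ≤ A·C`
(`mainOrder_norm_sq_le`, `discreteForm_mainOrder_norm_sq_le`) — so NO detector whose weight is `≥ 0` on the
sampled zeros closes a Cauchy–Schwarz endgame at main order, whatever its main-term calculus
(`not_mainOrder_closing`). This is the abstract twin of `Repair.not_repairable_true_need`'s conclusion
`¬ (C₂₃₂·C₂₃₃ < ‖dSum‖²)`, with the dictionary hypotheses replaced by «the three constants ARE main-order
limits of one non-negatively weighted discrete form».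

**Part 2 — formula I with a detector RECIPE.** In the manuscript the detector weight
`𝔠*(ρ,ψ) = −iM(ρ+β₁)M(ρ+β₂)M(ρ+β₃)/M′(ρ)` (shift multiples `b = (1,2,3)`, `β_j = ib_jα`, `α = π/log P`
(2.10), (2.13)) enters the main term of `Θ₁` (Prop 7.1) through THREE RESIDUE CHANNELS `j` — the residues `ℛ_j`
of `ζ(s+β₁)ζ(s+β₂)ζ(s+β₃)δ(s)/ζ(s)` at `s = 1 − β_j` ((7.19)–(7.20)) — each contributing
`W_j·∫₀¹(g′ + iπb_j g)·conj(h′ + iπs_j h + π²n_j∫_y^1 h)` with `W = (½, 2, 3/2)` (the display of Prop 7.1,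
from `iℛ_jp^{−β_j} = W_j/α + O(𝓛)` after (7.21)), `s_j = Σ_{i≠j} b_i = (5,4,3)`, `n_j = Π_{i≠j} b_i = (6,3,2)`
(Lemmas 8.2/8.4; the tree's `Repair.bS`, `Repair.bN`, `Repair.Mform`). `DetRecipe` makes the channel data
`(W_j ∈ ℂ, b_j, s_j, n_j)` a PARAMETER; `MformDet R` is formula I with recipe `R`, `FormDetPolar R` its Hermitian
symmetrisation `M_R(g,h) + conj M_R(h,g)`, `FormDet R g = Re FormDetPolar R g g` the diagonal main-term form
`𝔅_R`. Faithfulness (PROVED): `MformDet zhangRecipe = Repair.Mform` (`MformDet_zhang`), hence on one-sided kinked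
profiles `FormDetPolar zhangRecipe = mainTermFormPolar` and `FormDet zhangRecipe = mainTermForm ≥ 0`
(`FormDetPolar_zhang`, `FormDet_zhang`, `formDetPSD_zhang` — via `Repair.mainTermFormPolar_eq_Mform` and
`mainTermForm_nonneg_of_isH1`).

**Part 3 — the shift-triple CANDIDATE recipe (derivation, UNREVIEWED).** For a general real shift triple `b`
(`β_j = ib_jα`) the same residue bookkeeping READ OFF the printed proof — `ζ(1+z) ∼ 1/z`, `1/ζ(1−β_j) ∼ −β_j`,
`δ(1−β_j) = 1 + O(α log 𝓛)` (Lemma 5.4 (ii)), `p^{−β_j} ∼ e^{−iπb_j}` by (2.10), and the prefactor `−i(pt₀)^{β₃}`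
of (7.1) read as `−i(pt₀)^{(β₁+β₂+β₃)/2}` — gives `W_j(b) = b_j·e^{iπ(s_j − b_j)/2}/Π_{i≠j}(b_i − b_j)`
(`shiftW`), complex unless the phases align; `shiftRecipe b = (W(b), b, s(b), n(b))` and PROVED
`shiftRecipe_std : shiftRecipe ![1,2,3] = zhangRecipe` (it reproduces `(½,2,3/2)`, `(5,4,3)`, `(6,3,2)`).
STATUS of `shiftW` as the weight the manuscript's §§7–8 WOULD produce for the detector
`Π_jM(ρ+β_j)/(iM′(ρ))` with shift multiples `b`: a derivation target of the cell (registry row E-010 «E*-S»,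
first half), in-house and unreviewed — NOT a claim of this file; the second half of E-010 is the bare `Prop`
`FormDetPSD (shiftRecipe b)` below.

**Part 4 — statement vocabulary (bare `Prop`s, none asserted).** `FormDetPSD R` («`𝔅_R ≥ 0` on one-sided
kinked profiles», the shape of E*-S (ii)), `FormDetNegWitness R` (its negation with a witness,
`not_formDetPSD_iff`). `formDetPSD_zhang` is the printed instance, a theorem.

**Deliberately NOT here:** the formula-II / glue terms (Prop 14.1, Lemma 15.1) a two-sided (reflected) design
needs for a general recipe — this file is one-sided (`g(1) = 0`, the range (7.2)); detectors with `|S| ≠ 3`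
channels or with `(iM′)^{−m}`, `m ≠ 1` (other operator shapes); any error term. Elementary calculus and linear
algebra throughout; every declaration is tagged with the display of the manuscript whose object it types or
whose role it proves (the mathematics of Parts 1–2 is standard linear algebra / calculus).
-/

noncomputable section

open Complex Real ComplexConjugate Set MeasureTheory intervalIntegral Filter
open scoped Topology

namespace Literature.NumberTheory.LFunctions.Zhang2022

namespace Det

/-! ### Part 1 — the discrete form of a detector; exact Cauchy–Schwarz (B1) and its main-order shadow (B2) -/

section Discrete

variable {ι : Type*}

/-- **The discrete form of a detector with weight `w`** on a finite set `Z` of sampled zeros: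
`Ξ_w(u,v) = Σ_{ρ∈Z} w(ρ)·u(ρ)·conj v(ρ)`. The manuscript's (2.16)/(2.17)/(2.32)/(2.33) are values of this form
with `Z = {(ψ,ρ) : ψ ∈ Ψ₁, ρ ∈ 𝔷(ψ)}` and `w = 𝔠*(ρ,ψ)ω(ρ)` (real by (2.11)–(2.12), `≥ 0` by Lemma 2.3); an
alternative detector is another `w`. [cite: Zhang2022LandauSiegel, §2 (2.16)–(2.17)] -/
def discreteForm (Z : Finset ι) (w : ι → ℝ) (u v : ι → ℂ) : ℂ :=
  ∑ ρ ∈ Z, (w ρ : ℂ) * (u ρ * conj (v ρ))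

variable (Z : Finset ι) (w : ι → ℝ) (u v : ι → ℂ)

/-- Hermitian symmetry `Ξ_w(v,u) = conj Ξ_w(u,v)` (real weight, (2.11)–(2.12)). [cite: Zhang2022LandauSiegel, §2 (2.11)–(2.12), (2.16)] -/
theorem discreteForm_swap : discreteForm Z w v u = conj (discreteForm Z w u v) := by
  unfold discreteForm
  rw [map_sum]
  refine Finset.sum_congr rfl fun ρ _ => ?_
  simp only [map_mul, Complex.conj_ofReal, Complex.conj_conj]
  ring

/-- The diagonal `Ξ_w(u,u) = Σ w(ρ)‖u(ρ)‖²` (as a complex number) — the left sides of (2.16), (2.32), (2.33).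
[cite: Zhang2022LandauSiegel, §2 (2.16), (2.32)–(2.33)] -/
theorem discreteForm_self : discreteForm Z w u u = ((∑ ρ ∈ Z, w ρ * ‖u ρ‖ ^ 2 : ℝ) : ℂ) := by
  unfold discreteForm
  push_cast
  refine Finset.sum_congr rfl fun ρ _ => ?_
  rw [Complex.mul_conj']

/-- `Re Ξ_w(u,u) = Σ w(ρ)‖u(ρ)‖²`. [cite: Zhang2022LandauSiegel, §2 (2.16), (2.32)–(2.33)] -/
theorem discreteForm_self_re : (discreteForm Z w u u).re = ∑ ρ ∈ Z, w ρ * ‖u ρ‖ ^ 2 := by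
  rw [discreteForm_self, Complex.ofReal_re]

/-- `Im Ξ_w(u,u) = 0`. [cite: Zhang2022LandauSiegel, §2 (2.16), (2.32)–(2.33)] -/
theorem discreteForm_self_im : (discreteForm Z w u u).im = 0 := by
  rw [discreteForm_self, Complex.ofReal_im]

variable {Z w}

/-- **(2.16): `Ξ_w(u,u) ≥ 0` for a non-negative weight** (Lemma 2.3's role). [cite: Zhang2022LandauSiegel, §2 (2.16)] -/
theorem discreteForm_self_nonneg (hw : ∀ ρ ∈ Z, 0 ≤ w ρ) (u : ι → ℂ) :
    0 ≤ (discreteForm Z w u u).re := by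
  rw [discreteForm_self_re]
  exact Finset.sum_nonneg fun ρ hρ => mul_nonneg (hw ρ hρ) (by positivity)

/-- The triangle step behind (2.18)–(2.19): `‖Ξ_w(u,v)‖ ≤ Σ w‖u‖‖v‖` for `w ≥ 0`.
[cite: Zhang2022LandauSiegel, §2 (2.18)–(2.19)] -/
theorem norm_discreteForm_le (hw : ∀ ρ ∈ Z, 0 ≤ w ρ) (u v : ι → ℂ) :
    ‖discreteForm Z w u v‖ ≤ ∑ ρ ∈ Z, w ρ * (‖u ρ‖ * ‖v ρ‖) := by
  unfold discreteForm
  refine (norm_sum_le _ _).trans (Finset.sum_le_sum fun ρ hρ => ?_)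
  rw [norm_mul, norm_mul, Complex.norm_conj, Complex.norm_real, Real.norm_of_nonneg (hw ρ hρ)]

/-- **(B1) EXACT CAUCHY–SCHWARZ for every non-negatively weighted detector:**
`‖Ξ_w(u,v)‖² ≤ Ξ_w(u,u)·Ξ_w(v,v)` — «(2.32) and (2.33) give Prop 2.5 by Cauchy's inequality (and Lemma 2.3)»,
for ANY weight `w ≥ 0` on the sampled zeros. [cite: Zhang2022LandauSiegel, §2 (2.18)–(2.19), (2.32)–(2.33)] -/
theorem norm_sq_discreteForm_le (hw : ∀ ρ ∈ Z, 0 ≤ w ρ) (u v : ι → ℂ) :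
    ‖discreteForm Z w u v‖ ^ 2 ≤ (discreteForm Z w u u).re * (discreteForm Z w v v).re := by
  rw [discreteForm_self_re, discreteForm_self_re]
  have h1 : ‖discreteForm Z w u v‖
      ≤ ∑ ρ ∈ Z, (Real.sqrt (w ρ) * ‖u ρ‖) * (Real.sqrt (w ρ) * ‖v ρ‖) := by
    refine (norm_discreteForm_le hw u v).trans (le_of_eq (Finset.sum_congr rfl fun ρ hρ => ?_))
    have hs : Real.sqrt (w ρ) * Real.sqrt (w ρ) = w ρ := Real.mul_self_sqrt (hw ρ hρ)
    calc w ρ * (‖u ρ‖ * ‖v ρ‖) = (Real.sqrt (w ρ) * Real.sqrt (w ρ)) * (‖u ρ‖ * ‖v ρ‖) := by rw [hs]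
      _ = (Real.sqrt (w ρ) * ‖u ρ‖) * (Real.sqrt (w ρ) * ‖v ρ‖) := by ring
  have h2 := Finset.sum_mul_sq_le_sq_mul_sq Z (fun ρ => Real.sqrt (w ρ) * ‖u ρ‖)
    (fun ρ => Real.sqrt (w ρ) * ‖v ρ‖)
  have h3 : ∀ ρ ∈ Z, (Real.sqrt (w ρ) * ‖u ρ‖) ^ 2 = w ρ * ‖u ρ‖ ^ 2 := fun ρ hρ => by
    rw [mul_pow, Real.sq_sqrt (hw ρ hρ)]
  have h4 : ∀ ρ ∈ Z, (Real.sqrt (w ρ) * ‖v ρ‖) ^ 2 = w ρ * ‖v ρ‖ ^ 2 := fun ρ hρ => by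
    rw [mul_pow, Real.sq_sqrt (hw ρ hρ)]
  rw [Finset.sum_congr rfl h3, Finset.sum_congr rfl h4] at h2
  exact (pow_le_pow_left₀ (norm_nonneg _) h1 2).trans h2

/-- **Consequence: a CS endgame cannot close on the nose.** For `w ≥ 0` never
`Ξ_w(u,u)·Ξ_w(v,v) < ‖Ξ_w(u,v)‖²`. [cite: Zhang2022LandauSiegel, §2 (2.18)–(2.19), (2.32)–(2.33)] -/
theorem not_discreteForm_closing (hw : ∀ ρ ∈ Z, 0 ≤ w ρ) (u v : ι → ℂ) :
    ¬ ((discreteForm Z w u u).re * (discreteForm Z w v v).re < ‖discreteForm Z w u v‖ ^ 2) :=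
  not_lt.mpr (norm_sq_discreteForm_le hw u v)

end Discrete

section MainOrder

variable {α : Type*} {l : Filter α}

/-- **(B2) Cauchy–Schwarz at MAIN ORDER.** If three quantities satisfy `‖q_uv‖² ≤ q_uu·q_vv` at every stage of a
filter and, normalised by a positive scale `X` (the manuscript: `X = 𝔞𝔓`), converge to constants `A`, `C`, `B`,
then `‖B‖² ≤ A·C`: main-order constants of ONE non-negatively weighted discrete form can never violate CS
(the main-order reading of «(2.18), Props 2.4, 2.5, 2.6 ⇒ contradiction», §2 p.6).
[cite: Zhang2022LandauSiegel, §2 (2.18)–(2.19), Props 2.4–2.6 p.6] -/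
theorem mainOrder_norm_sq_le [l.NeBot] {X quu qvv : α → ℝ} {quv : α → ℂ} {A C : ℝ} {B : ℂ}
    (hcs : ∀ᶠ a in l, ‖quv a‖ ^ 2 ≤ quu a * qvv a) (hX : ∀ᶠ a in l, 0 < X a)
    (hu : Tendsto (fun a => quu a / X a) l (𝓝 A)) (hv : Tendsto (fun a => qvv a / X a) l (𝓝 C))
    (huv : Tendsto (fun a => quv a / (X a : ℂ)) l (𝓝 B)) :
    ‖B‖ ^ 2 ≤ A * C := by
  have h1 : Tendsto (fun a => ‖quv a / (X a : ℂ)‖ ^ 2) l (𝓝 (‖B‖ ^ 2)) := (huv.norm).pow 2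
  have h2 : Tendsto (fun a => quu a / X a * (qvv a / X a)) l (𝓝 (A * C)) := hu.mul hv
  refine le_of_tendsto_of_tendsto h1 h2 ?_
  filter_upwards [hcs, hX] with a ha hXa
  rw [norm_div, Complex.norm_real, Real.norm_of_nonneg hXa.le, div_pow, div_mul_div_comm, ← pow_two]
  gcongr

/-- **(B2), contrapositive form used by the cell** («no design closes at main order»): under the hypotheses of
`mainOrder_norm_sq_le`, `¬ (A·C < ‖B‖²)` — the shape of `Repair.not_repairable_true_need`'s conclusion.
[cite: Zhang2022LandauSiegel, §2 (2.18)–(2.19), Props 2.4–2.6 p.6] -/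
theorem not_mainOrder_closing [l.NeBot] {X quu qvv : α → ℝ} {quv : α → ℂ} {A C : ℝ} {B : ℂ}
    (hcs : ∀ᶠ a in l, ‖quv a‖ ^ 2 ≤ quu a * qvv a) (hX : ∀ᶠ a in l, 0 < X a)
    (hu : Tendsto (fun a => quu a / X a) l (𝓝 A)) (hv : Tendsto (fun a => qvv a / X a) l (𝓝 C))
    (huv : Tendsto (fun a => quv a / (X a : ℂ)) l (𝓝 B)) :
    ¬ (A * C < ‖B‖ ^ 2) :=
  not_lt.mpr (mainOrder_norm_sq_le hcs hX hu hv huv)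

/-- **(B1) + (B2) for detectors:** along any filter of designs `a` (the manuscript: `P → ∞` under (A)) with
finite sampled sets `Z a`, weights `w a ≥ 0` there, test vectors `u a`, `v a` and scale `X a > 0`, the
main-order constants `A, C, B` of `Ξ(u,u), Ξ(v,v), Ξ(u,v)` satisfy `‖B‖² ≤ A·C`.
[cite: Zhang2022LandauSiegel, §2 (2.16)–(2.19), Props 2.4–2.6 p.6] -/
theorem discreteForm_mainOrder_norm_sq_le [l.NeBot] {ι : Type*} (Z : α → Finset ι) (w : α → ι → ℝ)
    (u v : α → ι → ℂ) (X : α → ℝ) (hw : ∀ᶠ a in l, ∀ ρ ∈ Z a, 0 ≤ w a ρ) (hX : ∀ᶠ a in l, 0 < X a)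
    {A C : ℝ} {B : ℂ}
    (hu : Tendsto (fun a => (discreteForm (Z a) (w a) (u a) (u a)).re / X a) l (𝓝 A))
    (hv : Tendsto (fun a => (discreteForm (Z a) (w a) (v a) (v a)).re / X a) l (𝓝 C))
    (huv : Tendsto (fun a => discreteForm (Z a) (w a) (u a) (v a) / (X a : ℂ)) l (𝓝 B)) :
    ‖B‖ ^ 2 ≤ A * C :=
  mainOrder_norm_sq_le (hw.mono fun _ ha => norm_sq_discreteForm_le ha _ _) hX hu hv huv

end MainOrder

/-! ### Part 2 — formula I with a three-channel detector recipe (definition request D-det-1) -/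

/-- **A three-channel detector recipe for formula I**: per residue channel `j` the weight `W_j ∈ ℂ` and the
coefficients `(b_j, s_j, n_j)` of the integrand `(g′ + iπb_j g)·conj(h′ + iπs_j h + π²n_j ∫_y^1 h)`. The
manuscript's detector is `zhangRecipe` (`W = (½,2,3/2)`, `b = (1,2,3)`, `s = (5,4,3)`, `n = (6,3,2)`); another
detector of the same operator shape is another point of this parameter space. [cite: Zhang2022LandauSiegel, Prop 7.1 p.44, (8.11)–(8.12)] -/
@[ext] structure DetRecipe where
  /-- residue weights `W_j` (Prop 7.1: `½, 2, 3/2`) -/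
  W : Fin 3 → ℂ
  /-- first-slot shift multiples `b_j`: the factor `g′ + iπb_j g` (Lemma 8.2) -/
  b : Fin 3 → ℝ
  /-- second-slot linear coefficients `s_j`: the term `iπs_j h` (Lemma 8.4; printed `β_{j+1}+β_{j+2} ↔ 5,4,3`) -/
  s : Fin 3 → ℝ
  /-- second-slot tail coefficients `n_j`: the term `π²n_j∫_y^1 h` (Lemma 8.4; printed `β_{j+1}β_{j+2} ↔ 6,3,2`) -/
  n : Fin 3 → ℝ

/-- One channel's integrand with free coefficients `(b, s, n)`:
`(g′ + iπb g)(y)·conj[h′ + iπs h + π²n ∫_y^1 h](y)` (`Repair.dipoleIntegrand j` is `(b,s,n) = (j, bS j, bN j)`).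
[cite: Zhang2022LandauSiegel, Prop 7.1, Lemmas 8.2/8.4] -/
def dipoleIntegrandDet (b s n : ℝ) (g g' h h' : ℝ → ℂ) (y : ℝ) : ℂ :=
  (g' y + I * π * (b : ℂ) * g y)
    * conj (h' y + I * π * (s : ℂ) * h y + (π : ℂ) ^ 2 * (n : ℂ) * ∫ t in y..1, h t)

/-- **Formula I with recipe `R`:** `M_R(g,h) = (1/π) Σ_j W_j ∫₀¹ (g′+iπb_jg)·conj(h′+iπs_jh+π²n_j∫_y^1h)`.
[cite: Zhang2022LandauSiegel, Prop 7.1 p.44, (8.11)–(8.12)] -/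
def MformDet (R : DetRecipe) (g g' h h' : ℝ → ℂ) : ℂ :=
  (((1 / π : ℝ)) : ℂ) *
    ∑ j : Fin 3, R.W j * ∫ y in (0:ℝ)..1, dipoleIntegrandDet (R.b j) (R.s j) (R.n j) g g' h h' y

/-- **The polar main-term form of recipe `R`:** `P_R(g,h) = M_R(g,h) + conj M_R(h,g)` (for `zhangRecipe` and
one-sided kinked profiles this is `mainTermFormPolar`, `FormDetPolar_zhang`). [cite: Zhang2022LandauSiegel, Prop 7.1 p.44, (8.11)–(8.12)] -/
def FormDetPolar (R : DetRecipe) (g g' h h' : ℝ → ℂ) : ℂ :=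
  MformDet R g g' h h' + conj (MformDet R h h' g g')

/-- **`𝔅_R(g) = Re P_R(g,g) = 2Re M_R(g,g)`, the diagonal main-term form of the detector recipe `R`**
(the object `𝔅_det` / `𝔅_S` of the cell's OBJECTIVE §2.2). [cite: Zhang2022LandauSiegel, Prop 7.1 p.44, (8.11)–(8.12)] -/
def FormDet (R : DetRecipe) (g g' : ℝ → ℂ) : ℝ := (FormDetPolar R g g' g g').re

variable (R : DetRecipe) (g g' h h' : ℝ → ℂ)

/-- Hermitian symmetry `P_R(h,g) = conj P_R(g,h)`. [cite: Zhang2022LandauSiegel, Prop 7.1 p.44, (8.11)–(8.12)] -/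
theorem formDetPolar_swap : FormDetPolar R h h' g g' = conj (FormDetPolar R g g' h h') := by
  simp only [FormDetPolar, map_add, Complex.conj_conj, add_comm]

/-- `Im P_R(g,g) = 0`. [cite: Zhang2022LandauSiegel, Prop 7.1 p.44, (8.11)–(8.12)] -/
theorem formDetPolar_self_im : (FormDetPolar R g g' g g').im = 0 := by
  simp [FormDetPolar, Complex.add_im, Complex.conj_im]

/-- `P_R(g,g) = 𝔅_R(g)` as a complex number. [cite: Zhang2022LandauSiegel, Prop 7.1 p.44, (8.11)–(8.12)] -/
theorem formDetPolar_self : FormDetPolar R g g' g g' = (FormDet R g g' : ℂ) := by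
  apply Complex.ext
  · simp [FormDet]
  · rw [formDetPolar_self_im, Complex.ofReal_im]

/-- `𝔅_R(g) = 2 Re M_R(g,g)` (the «`2Re Θ₁`» bookkeeping of (8.1)/(8.23)). [cite: Zhang2022LandauSiegel, Prop 7.1 p.44, §8 (8.1), (8.23)] -/
theorem formDet_eq_two_mul_re : FormDet R g g' = 2 * (MformDet R g g' g g').re := by
  simp only [FormDet, FormDetPolar, Complex.add_re, Complex.conj_re]
  ring

/-- **The manuscript's detector as a recipe:** `W = (½, 2, 3/2)`, `b = (1,2,3)`, `s = (5,4,3)`, `n = (6,3,2)`.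
[cite: Zhang2022LandauSiegel, Prop 7.1 p.44, (8.13)–(8.18)] -/
def zhangRecipe : DetRecipe where
  W := ![1 / 2, 2, 3 / 2]
  b := ![1, 2, 3]
  s := ![5, 4, 3]
  n := ![6, 3, 2]

/-- Channel `0 ↔ j = 1` of the printed recipe is `Repair.dipoleIntegrand 1`. [cite: Zhang2022LandauSiegel, §8 (8.13), (8.16)] -/
theorem dipoleIntegrandDet_zhang_zero :
    dipoleIntegrandDet (zhangRecipe.b 0) (zhangRecipe.s 0) (zhangRecipe.n 0) g g' h h'
      = Repair.dipoleIntegrand 1 g g' h h' := by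
  funext y
  simp only [dipoleIntegrandDet, Repair.dipoleIntegrand, zhangRecipe, Repair.bS_one, Repair.bN_one,
    Matrix.cons_val_zero]
  push_cast
  ring

/-- Channel `1 ↔ j = 2` of the printed recipe is `Repair.dipoleIntegrand 2`. [cite: Zhang2022LandauSiegel, §8 (8.14), (8.17)] -/
theorem dipoleIntegrandDet_zhang_one :
    dipoleIntegrandDet (zhangRecipe.b 1) (zhangRecipe.s 1) (zhangRecipe.n 1) g g' h h'
      = Repair.dipoleIntegrand 2 g g' h h' := by
  funext y
  simp only [dipoleIntegrandDet, Repair.dipoleIntegrand, zhangRecipe, Repair.bS_two, Repair.bN_two,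
    Matrix.cons_val_one]
  push_cast
  ring

/-- Channel `2 ↔ j = 3` of the printed recipe is `Repair.dipoleIntegrand 3`. [cite: Zhang2022LandauSiegel, §8 (8.15), (8.18)] -/
theorem dipoleIntegrandDet_zhang_two :
    dipoleIntegrandDet (zhangRecipe.b 2) (zhangRecipe.s 2) (zhangRecipe.n 2) g g' h h'
      = Repair.dipoleIntegrand 3 g g' h h' := by
  funext y
  simp only [dipoleIntegrandDet, Repair.dipoleIntegrand, zhangRecipe, Repair.bS_three, Repair.bN_three,
    Matrix.cons_val_two, Matrix.tail_cons, Matrix.head_cons]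
  push_cast
  ring

/-- **Faithfulness: formula I with the printed recipe IS the tree's formula I** (`Repair.Mform`).
[cite: Zhang2022LandauSiegel, Prop 7.1 p.44, (8.11)–(8.12)] -/
theorem MformDet_zhang : MformDet zhangRecipe g g' h h' = Repair.Mform g g' h h' := by
  simp only [MformDet, Repair.Mform, Fin.sum_univ_three]
  rw [dipoleIntegrandDet_zhang_zero, dipoleIntegrandDet_zhang_one, dipoleIntegrandDet_zhang_two]
  simp only [zhangRecipe, Matrix.cons_val_zero, Matrix.cons_val_one, Matrix.cons_val_two, Matrix.head_cons,
    Matrix.tail_cons]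

variable {g g' h h'}

/-- **Faithfulness on profiles:** for one-sided kinked profiles the polar form of the printed recipe is the
tree's `mainTermFormPolar` (the Gram identity `Repair.mainTermFormPolar_eq_Mform`).
[cite: Zhang2022LandauSiegel, Prop 7.1 with (8.11)–(8.23), pp.44–50] -/
theorem FormDetPolar_zhang (hg : Repair.KinkedProfile g g') (hh : Repair.KinkedProfile h h')
    (hg1 : g 1 = 0) (hh1 : h 1 = 0) :
    FormDetPolar zhangRecipe g g' h h' = mainTermFormPolar g g' h h' := by
  rw [FormDetPolar, MformDet_zhang, MformDet_zhang, Repair.mainTermFormPolar_eq_Mform hg hh hg1 hh1]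

/-- **`𝔅_{zhang}(g) = 𝔅(g)`** (`MainTermFormPSD.mainTermForm`) on one-sided kinked profiles.
[cite: Zhang2022LandauSiegel, Prop 7.1 with (8.11)–(8.23), pp.44–50] -/
theorem FormDet_zhang (hg : Repair.KinkedProfile g g') (hg1 : g 1 = 0) :
    FormDet zhangRecipe g g' = mainTermForm g g' := by
  rw [FormDet, FormDetPolar_zhang hg hg hg1 hg1, mainTermFormPolar_self, Complex.ofReal_re]

/-- `𝔅_{zhang}(g) ≥ 0` on one-sided kinked profiles (the PSD theorem `mainTermForm_nonneg_of_isH1`).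
[cite: Zhang2022LandauSiegel, Prop 7.1 with (8.11)–(8.23), pp.44–50] -/
theorem FormDet_zhang_nonneg (hg : Repair.KinkedProfile g g') (hg1 : g 1 = 0) :
    0 ≤ FormDet zhangRecipe g g' := by
  rw [FormDet_zhang hg hg1]
  exact mainTermForm_nonneg_of_isH1 hg.isH1

/-! ### Part 3 — the shift-triple candidate recipe (residue bookkeeping read off (7.19)–(7.21); UNREVIEWED) -/

/-- Complementary sums `s_j(b) = Σ_{i≠j} b_i` (printed `β_{j+1} + β_{j+2}`, indices mod 3).
[cite: Zhang2022LandauSiegel, §8 (8.13)–(8.18)] -/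
def shiftS (b : Fin 3 → ℝ) : Fin 3 → ℝ := ![b 1 + b 2, b 2 + b 0, b 0 + b 1]

/-- Complementary products `n_j(b) = Π_{i≠j} b_i` (printed `β_{j+1}β_{j+2}`, indices mod 3).
[cite: Zhang2022LandauSiegel, §8 (8.13)–(8.18)] -/
def shiftN (b : Fin 3 → ℝ) : Fin 3 → ℝ := ![b 1 * b 2, b 2 * b 0, b 0 * b 1]

/-- Vandermonde-type denominators `v_j(b) = Π_{i≠j}(b_i − b_j)` of the residues `ℛ_j` (from `ζ(1+z) ∼ 1/z` at
`z = β_i − β_j`). [cite: Zhang2022LandauSiegel, proof of Prop 7.1, (7.19)–(7.20)] -/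
def shiftVdm (b : Fin 3 → ℝ) : Fin 3 → ℝ :=
  ![(b 1 - b 0) * (b 2 - b 0), (b 2 - b 1) * (b 0 - b 1), (b 0 - b 2) * (b 1 - b 2)]

/-- **CANDIDATE channel weights for a real shift triple `b`** (`β_j = ib_jα`):
`W_j(b) = b_j·e^{iπ(s_j(b) − b_j)/2}/v_j(b)` — the residue `ℛ_j` of `ζ(s+β₁)ζ(s+β₂)ζ(s+β₃)δ(s)/ζ(s)` at
`1 − β_j` (`ζ(1+z) ∼ 1/z`, `1/ζ(1−β_j) ∼ −β_j`, `δ = 1 + O(α log 𝓛)` by Lemma 5.4 (ii)), times `p^{−β_j} ∼ e^{−iπb_j}`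
((2.10)) and the prefactor `−i(pt₀)^{β₃}` of (7.1) read as `−i(pt₀)^{(β₁+β₂+β₃)/2}`. DERIVATION STATUS: in-house,
UNREVIEWED (registry E-010, first half) — the printed case is `shiftRecipe_std`; nothing asserts that §§7–8 with
the detector `Π_jM(ρ+β_j)/(iM′(ρ))` yields these weights for other `b`.
[cite: Zhang2022LandauSiegel, proof of Prop 7.1, (7.19)–(7.21)] -/
def shiftW (b : Fin 3 → ℝ) (j : Fin 3) : ℂ :=
  (b j : ℂ) * cexp (I * π * (((shiftS b j - b j) / 2 : ℝ) : ℂ)) / (shiftVdm b j : ℂ)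

/-- **The shift-triple candidate recipe** `(W(b), b, s(b), n(b))`. [cite: Zhang2022LandauSiegel, proof of Prop 7.1, (7.19)–(7.21)] -/
def shiftRecipe (b : Fin 3 → ℝ) : DetRecipe := ⟨shiftW b, b, shiftS b, shiftN b⟩

/-- `s(1,2,3) = (5,4,3)` (`= Repair.bS`). [cite: Zhang2022LandauSiegel, §8 (8.13)–(8.18)] -/
theorem shiftS_std : shiftS ![1, 2, 3] = ![5, 4, 3] := by
  funext j
  fin_cases j <;> (simp [shiftS]; try norm_num)

/-- `n(1,2,3) = (6,3,2)` (`= Repair.bN`). [cite: Zhang2022LandauSiegel, §8 (8.13)–(8.18)] -/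
theorem shiftN_std : shiftN ![1, 2, 3] = ![6, 3, 2] := by
  funext j
  fin_cases j <;> (simp [shiftN]; try norm_num)

/-- `v(1,2,3) = (2,−1,2)`. [cite: Zhang2022LandauSiegel, proof of Prop 7.1, (7.19)–(7.20)] -/
theorem shiftVdm_std : shiftVdm ![1, 2, 3] = ![2, -1, 2] := by
  funext j
  fin_cases j <;> (simp [shiftVdm]; try norm_num)

/-- **`W(1,2,3) = (½, 2, 3/2)`** — the candidate reproduces Prop 7.1's weights (phases `e^{2πi} = 1`,
`e^{iπ} = −1`, `e^0 = 1` against `v = (2,−1,2)`). [cite: Zhang2022LandauSiegel, Prop 7.1 p.44; (7.20)–(7.21)] -/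
theorem shiftW_std : shiftW ![1, 2, 3] = ![1 / 2, 2, 3 / 2] := by
  funext j
  fin_cases j
  · simp only [shiftW, shiftS, shiftVdm]
    simp only [Fin.zero_eta, Fin.isValue, Matrix.cons_val_zero, Matrix.cons_val_one, Matrix.head_cons,
      Matrix.cons_val_two, Matrix.tail_cons]
    have h : cexp (I * π * (((2 + 3 - 1) / 2 : ℝ) : ℂ)) = 1 := by
      rw [show (((2 + 3 - 1) / 2 : ℝ) : ℂ) = 2 by push_cast; norm_num,
        show I * π * 2 = 2 * π * I by ring, Complex.exp_two_pi_mul_I]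
    rw [h]
    push_cast
    norm_num
  · simp only [shiftW, shiftS, shiftVdm]
    simp only [Fin.mk_one, Fin.isValue, Matrix.cons_val_zero, Matrix.cons_val_one, Matrix.head_cons,
      Matrix.cons_val_two, Matrix.tail_cons]
    have h : cexp (I * π * (((3 + 1 - 2) / 2 : ℝ) : ℂ)) = -1 := by
      rw [show (((3 + 1 - 2) / 2 : ℝ) : ℂ) = 1 by push_cast; norm_num,
        show I * π * 1 = π * I by ring, Complex.exp_pi_mul_I]
    rw [h]
    push_cast
    norm_num
  · simp only [shiftW, shiftS, shiftVdm]
    simp only [Fin.reduceFinMk, Fin.isValue, Matrix.cons_val_zero, Matrix.cons_val_one, Matrix.head_cons,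
      Matrix.cons_val_two, Matrix.tail_cons]
    have h : cexp (I * π * (((1 + 2 - 3) / 2 : ℝ) : ℂ)) = 1 := by
      rw [show (((1 + 2 - 3) / 2 : ℝ) : ℂ) = 0 by push_cast; norm_num, mul_zero, Complex.exp_zero]
    rw [h]
    push_cast
    norm_num

/-- **The candidate recipe at `b = (1,2,3)` IS the manuscript's recipe.**
[cite: Zhang2022LandauSiegel, Prop 7.1 p.44; (7.20)–(7.21); (8.13)–(8.18)] -/
theorem shiftRecipe_std : shiftRecipe ![1, 2, 3] = zhangRecipe := by
  simp only [shiftRecipe, zhangRecipe, shiftW_std, shiftS_std, shiftN_std]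

/-! ### Part 4 — statement vocabulary (bare `Prop`s; none asserted except the printed instance) -/

/-- **E*-S (ii) shape — `𝔅_R` POSITIVE SEMIDEFINITE on one-sided kinked profiles** (the class of Prop 7.1's
range (7.2): support `< P`, `g(1) = 0`). For `R = zhangRecipe` a theorem (`formDetPSD_zhang`); for other
recipes NOT asserted (registry E-010, second half: «decidable in-house, one eigen-scan»).
[cite: Zhang2022LandauSiegel, Prop 7.1 p.44, (7.2)] -/
def FormDetPSD (R : DetRecipe) : Prop :=
  ∀ g g' : ℝ → ℂ, Repair.KinkedProfile g g' → g 1 = 0 → 0 ≤ FormDet R g g'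

/-- **The negation shape with a witness:** some one-sided kinked profile has `𝔅_R(g) < 0` (an indefinite
detector main-term form — what a B-det design outside `R̄` by the sign of its weights would have to exhibit).
[cite: Zhang2022LandauSiegel, Prop 7.1 p.44, (7.2)] -/
def FormDetNegWitness (R : DetRecipe) : Prop :=
  ∃ g g' : ℝ → ℂ, Repair.KinkedProfile g g' ∧ g 1 = 0 ∧ FormDet R g g' < 0

/-- `¬ FormDetPSD R ↔ FormDetNegWitness R`. [cite: Zhang2022LandauSiegel, Prop 7.1 p.44, (7.2)] -/
theorem not_formDetPSD_iff (R : DetRecipe) : ¬ FormDetPSD R ↔ FormDetNegWitness R := by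
  simp only [FormDetPSD, FormDetNegWitness, not_forall, not_le, exists_prop]

/-- **The printed instance of E*-S is a theorem:** `FormDetPSD zhangRecipe`.
[cite: Zhang2022LandauSiegel, Prop 7.1 with (8.11)–(8.23), pp.44–50] -/
theorem formDetPSD_zhang : FormDetPSD zhangRecipe := fun _ _ hg hg1 => FormDet_zhang_nonneg hg hg1

/-- and at `b = (1,2,3)` the shift-triple candidate is PSD (same statement through `shiftRecipe_std`).
[cite: Zhang2022LandauSiegel, Prop 7.1 with (8.11)–(8.23), pp.44–50] -/
theorem formDetPSD_shiftRecipe_std : FormDetPSD (shiftRecipe ![1, 2, 3]) := by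
  rw [shiftRecipe_std]
  exact formDetPSD_zhang

end Det

end Literature.NumberTheory.LFunctions.Zhang2022
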